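import Summits.AtomisticToContinuum.Crystallization.Theorems.FreeSplittingCertificatesStrictSplittingRuleP1FarLedger
import Summits.AtomisticToContinuum.Crystallization.Theorems.FreeSplittingCertificatesStrictSplittingRuleP1CellDefect

/-!
# `StrictSplittingRule` (stmt-AtomisticToContinuum-12560): THE FAR LEDGER AT A SITE modulo the per-cell budget WITH THE EXACT DEFECT FORM (P1 interpolant object, part 69)

Route `FreeSplittingCertificates`, crux r3 `StrictSplittingRule` (H12⋆ = `stub_coreJointCoercive`), unit b2b-freesplit-B gen 34.
VALUE = part 55 (`farLedger_le_of_cellBudget`) RE-THREADED on the exact vertex-quadrature defect of part 68: the same far-ledger inequality at a site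
`p` (lattice far demand ≤ far-table receipts + flux form) from the per-cell budget (B) stated with `p1CellDefectG` in place of the circumradius
majorant `(∫_T ω_rad)·ρ_T·|G|²_F` — i.e. `λ_max`-type dyad readout load + κ·(EXACT radial defect of T)(G) ≤ κ(5/2)(1/24)|G|²_F·∫_Tχ²|x−y_p|⁻⁶`
for every cell `T` and every `3 × 3` matrix `G`.  This is the statement the interval tier (`cellval.py`, HOME CERT §31) actually certifies (it bounds
the exact defect by the smaller of two majorants per cell), which the circumradius-form hypothesis of part 55 is NOT (gen-34 audit, CERT §34:
1 870 / 1 876 cells per parity exceed the circumradius-form budget at `f = 5/2`).  The circumradius data `(c_T, ρ_T)` are no longer hypotheses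
(they only serve the summability of the defect family, discharged inside part 68 from the honeycomb's table).  Proof = part 55's, with step (3)
replaced by `tsum_p1SiteBare_rad_le_defect_p1DispSite_translate`.  NOT a proof of H12⋆ ((B) is a hypothesis), NOT summit progress.  [folklore]
-/

noncomputable section

open Set Function Metric MeasureTheory Filter Topology
open scoped BigOperators NNReal ENNReal

namespace Summit.AtomisticToContinuum.Crystallization.Theorems.StrictSplittingRuleBirth

open Literature.MathematicalPhysics.StatisticalMechanics
open Summit.AtomisticToContinuum.Crystallization.Theorems.PalmUnimodularRigidity.LayeredLawsSelectHcp

/-- **THE FAR LEDGER AT A SITE, MODULO THE PER-CELL BUDGET WITH THE EXACT DEFECT.**  See the module docstring.  NOT a proof of H12⋆, NOT summit progress. -/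
theorem farLedger_le_of_cellBudget_exact {a h : ℝ} (ha : 0 < a) (hh : 0 < h) (hfam : HcpFamilyMin a h)
    (u : ℤ × ℤ × ℤ → EuclideanSpace ℝ (Fin 3)) (hu : (support u).Finite)
    (W : EuclideanSpace ℝ (Fin 3) →ₗ[ℝ] EuclideanSpace ℝ (Fin 3)) (hW : ∀ z : EuclideanSpace ℝ (Fin 3), inner ℝ (W z) z = 0)
    (A : Fin 3 → Fin 3 → ℝ) (hA : ∀ (y : EuclideanSpace ℝ (Fin 3)) (k : Fin 3), W y k = y 0 * A 0 k + y 1 * A 1 k + y 2 * A 2 k)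
    (b₀ : Fin 3 → ℝ) (p : ℤ × ℤ × ℤ) {R1 R2 : ℝ} (hR1 : 0 < R1) (hR12 : R1 < R2) {κ : ℝ} (hκ : 0 ≤ κ)
    -- in-layer far shares and their allocation table
    (w : (ℤ × ℤ × ℤ) × (ℤ × ℤ × ℤ) → ℝ) (hw : ∀ e, 0 ≤ w e)
    (hws : Summable fun e : (ℤ × ℤ × ℤ) × (ℤ × ℤ × ℤ) => w e * fpSq (fun k => hcpSite a h (e.1 + e.2) k - hcpSite a h e.1 k))
    (θ : (ℤ × ℤ × ℤ) × (ℤ × ℤ × ℤ) → (ℤ × ℤ × ℤ) × Fin 6 → ℝ) (hθ : ∀ e T, 0 ≤ θ e T)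
    (hfinE : ∀ e, (Function.support (θ e)).Finite) (hfinC : ∀ T, (Function.support fun e => θ e T).Finite)
    (hsum : ∀ e, w e ≠ 0 → ∑ᶠ T, θ e T = 1)
    (hcar : ∀ e T, θ e T ≠ 0 → ∃ m m' : Fin 4, e.1 = T.1 + p1VertOff (p1Par T.1) T.2 m ∧
      e.1 + e.2 = T.1 + p1VertOff (p1Par T.1) T.2 m')
    -- vertical far shares, routing offsets and their allocation table (unit row sums on the support of the routed leg weight)
    (sv : ℤ × ℤ × ℤ) (o : (ℤ × ℤ × ℤ) → Fin 3 → ℤ × ℤ × ℤ) (S : Finset (ℤ × ℤ × ℤ)) (ho : ∀ q i, o q i ∈ S)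
    (wv : ℤ × ℤ × ℤ → ℝ) (hwv : ∀ q, 0 ≤ wv q) (hwvs : Summable wv)
    (θv : (ℤ × ℤ × ℤ) × (ℤ × ℤ × ℤ) → (ℤ × ℤ × ℤ) × Fin 6 → ℝ) (hθv : ∀ e T, 0 ≤ θv e T)
    (hfinEv : ∀ e, (Function.support (θv e)).Finite) (hfinCv : ∀ T, (Function.support fun e => θv e T).Finite)
    (hsumv : ∀ e, (∑ i : Fin 3, (2 / 3) * ((if e.2 = o e.1 i then wv e.1 else 0) +
        (if o (e.1 - (sv - e.2)) i = sv - e.2 then wv (e.1 - (sv - e.2)) else 0))) ≠ 0 → ∑ᶠ T, θv e T = 1)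
    (hcarv : ∀ e T, θv e T ≠ 0 → ∃ m m' : Fin 4, e.1 = T.1 + p1VertOff (p1Par T.1) T.2 m ∧
      e.1 + e.2 = T.1 + p1VertOff (p1Par T.1) T.2 m')
    -- THE PER-CELL BUDGET (B): dyad readout + EXACT defect form, weights re-centred at `y_p`
    (hB : ∀ (T : (ℤ × ℤ × ℤ) × Fin 6) (G : Fin 3 → Fin 3 → ℝ),
      (∑ᶠ e : (ℤ × ℤ × ℤ) × (ℤ × ℤ × ℤ), θ e T * w e *
          fpSq (fun k => (hcpSite a h (e.1 + e.2) 0 - hcpSite a h e.1 0) * G 0 k +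
            (hcpSite a h (e.1 + e.2) 1 - hcpSite a h e.1 1) * G 1 k + (hcpSite a h (e.1 + e.2) 2 - hcpSite a h e.1 2) * G 2 k)) +
      (∑ᶠ e : (ℤ × ℤ × ℤ) × (ℤ × ℤ × ℤ), θv e T *
          (∑ i : Fin 3, (2 / 3) * ((if e.2 = o e.1 i then wv e.1 else 0) +
            (if o (e.1 - (sv - e.2)) i = sv - e.2 then wv (e.1 - (sv - e.2)) else 0))) *
          fpSq (fun k => (hcpSite a h (e.1 + e.2) 0 - hcpSite a h e.1 0) * G 0 k +
            (hcpSite a h (e.1 + e.2) 1 - hcpSite a h e.1 1) * G 1 k + (hcpSite a h (e.1 + e.2) 2 - hcpSite a h e.1 2) * G 2 k)) +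
      p1CellDefectG a h (fun y k l => κ * ((7 * (5 / 4 : ℝ) + 3 / 4) / 4) * fpChi (R1 ^ 2) (R2 ^ 2) (y - fun k => hcpSite a h p k) ^ 2 *
          (fpSq (y - fun k => hcpSite a h p k))⁻¹ ^ 5 * ((y - fun k => hcpSite a h p k) k * (y - fun k => hcpSite a h p k) l)) T G ≤
      κ * ((5 / 2 * (1 / 24 * fpSymSq G) + 5 / 2 * (1 / 24 * (fpFrob G - fpSymSq G))) *
        ∫ y in p1RealCell a h T, fpChi (R1 ^ 2) (R2 ^ 2) (y - fun k => hcpSite a h p k) ^ 2 * (fpSq (y - fun k => hcpSite a h p k))⁻¹ ^ 3)) :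
    (∑' e : (ℤ × ℤ × ℤ) × (ℤ × ℤ × ℤ), w e * ‖u (e.1 + e.2) - u e.1 - W (hcpSite a h (e.1 + e.2) - hcpSite a h e.1)‖ ^ 2) +
    (∑' q : ℤ × ℤ × ℤ, wv q * ‖u (q + sv) - u q - W (hcpSite a h (q + sv) - hcpSite a h q)‖ ^ 2) +
    (∑' q, p1SiteBare a h (fun y k l => κ * ((7 * (5 / 4 : ℝ) + 3 / 4) / 4) * fpChi (R1 ^ 2) (R2 ^ 2) (y - fun k => hcpSite a h p k) ^ 2 *
        (fpSq (y - fun k => hcpSite a h p k))⁻¹ ^ 5 * ((y - fun k => hcpSite a h p k) k * (y - fun k => hcpSite a h p k) l))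
        (fun n k => p1DispSite a h (fun n k => u n k) b₀ A n k) q) -
    (∑' q, p1SiteBare a h (fun y k l => κ * ((3 / 4 : ℝ) / 4) * fpChi (R1 ^ 2) (R2 ^ 2) (y - fun k => hcpSite a h p k) ^ 2 *
        (fpSq (y - fun k => hcpSite a h p k))⁻¹ ^ 4 * (if k = l then 1 else 0))
        (fun n k => p1DispSite a h (fun n k => u n k) b₀ A n k) q) ≤
    κ * (2 / 5) / a ^ 4 * (∑' q, ∑ d ∈ p1BondOffsets,
        p1RecTable a h (p1SplitDensity R1 R2) (p1Par q) (p - q) d *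
          (inner ℝ (hcpSite a h (q + d) - hcpSite a h q) (u (q + d) - u q)) ^ 2) +
    κ * ∑' i, p1FluxQuad₀ (R1 ^ 2) (R2 ^ 2) (1 / 3) (4 / 3) (-9 / 8) (1 / 8) a h (fun k => hcpSite a h p k) i
        (p1CellVals (fun n k => p1DispSite a h (fun n k => u n k) b₀ A n k) i) := by
  have ha' := ha.ne'
  have hh' := hh.ne'
  have hS1 : 0 < R1 ^ 2 := pow_pos hR1 2
  have hS12 : R1 ^ 2 < R2 ^ 2 := pow_lt_pow_left₀ hR12 hR1.le two_ne_zero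
  set y₀ : Fin 3 → ℝ := fun k => hcpSite a h p k with hy₀
  set U : ℤ × ℤ × ℤ → (Fin 3 → ℝ) := fun n k => u n k with hUdef
  have hU : (support U).Finite := by
    refine hu.subset fun n hn => ?_
    simp only [mem_support, ne_eq] at hn ⊢
    intro h0
    apply hn
    funext k
    show u n k = (0 : Fin 3 → ℝ) k
    rw [h0]
    rfl
  have hcrad : 0 ≤ κ * ((7 * (5 / 4 : ℝ) + 3 / 4) / 4) := mul_nonneg hκ (by norm_num)
  have hccred : 0 ≤ κ * ((3 / 4 : ℝ) / 4) := mul_nonneg hκ (by norm_num)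
  -- (1) in-layer readout → dyad cell family
  obtain ⟨hsDin, _, hle_in⟩ := tsum_readout_leg_table_le_dyad_p1DispSite' ha hh U hU b₀ A w hw θ hθ hfinE hfinC hsum hcar hws
  -- (2) vertical readout → routed dyad cell family
  obtain ⟨hsDv, hle_v⟩ := tsum_readout_route_le_table_dyad_p1DispSite' ha hh U hU b₀ A sv o S ho wv hwv hwvs θv hθv hfinEv hfinCv hsumv hcarv
  -- (3) radial deficit far shares ≤ continuum radial integral + EXACT defect (part 68)
  obtain ⟨hsDef, _, hle_rad⟩ := tsum_p1SiteBare_rad_le_defect_p1DispSite_translate ha hh hcrad hS1 hS12 U hU b₀ A y₀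
  -- (4) continuum credit ≤ credit far shares
  obtain ⟨_, hle_cred⟩ := integral_cred_le_tsum_p1SiteBare_p1DispSite_translate ha hh hccred hS1 hS12 U hU b₀ A y₀
  -- (5) the split of ∫χ²N_F2 and the gradient cell sum
  have hDC : (0 : ℝ) ≤ (7 * (5 / 4 : ℝ) + 3 / 4) / 4 := by norm_num
  have hC4 : (0 : ℝ) ≤ (3 / 4 : ℝ) / 4 := by norm_num
  obtain ⟨_, hsplit⟩ := integral_chiSq_fpNumI_split ha hh hS1 hS12 (5 / 2) (5 / 2) (5 / 4) (3 / 4) hDC hC4 U hU b₀ A y₀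
  have hgrad := integral_chiSq_grad_translate_eq_tsum ha hh hS1 hS12 (5 / 2) (5 / 2) (5 / 4) (3 / 4) hDC hC4 U hU b₀ A y₀
  have hsG := summable_grad_cellFamily_translate ha hh hS1 hS12 (5 / 2) (5 / 2) (5 / 4) (3 / 4) hDC hC4 U hU b₀ A y₀
  -- (6) the far half and the flux identification
  have hfar := farHalf_F2_le_skew ha hh hfam u hu W hW A hA b₀ p hR1 hR12 hκ
  have e98 : (-(9 / 8) : ℝ) = -9 / 8 := by norm_num
  rw [e98] at hfar
  have hflux := integral_flux_p1Disp_translate_eq_tsum_quad ha hh hS1 hS12 (1 / 3) (4 / 3) (-9 / 8) (1 / 8) U hU b₀ A y₀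
  -- (7) the exact defect family is summable: `hsDef` from part 68
  -- (8) sum the per-cell budget over the cells
  have hBsum := Summable.tsum_le_tsum (fun T => hB T (fun j k => p1CellGrad a h U T j k - A j k))
    ((hsDin.add hsDv).add hsDef) (hsG.mul_left κ)
  rw [(hsDin.add hsDv).tsum_add hsDef, hsDin.tsum_add hsDv, tsum_mul_left] at hBsum
  -- (9) constants: κ·∫rad and κ·∫cred versus the `c`-weighted integrals of parts 47
  have hIrad : (∫ x, κ * ((7 * (5 / 4 : ℝ) + 3 / 4) / 4) * fpChi (R1 ^ 2) (R2 ^ 2) x ^ 2 * (fpSq x)⁻¹ ^ 5 *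
        fpDot x (p1Disp a h U b₀ A (y₀ + x)) ^ 2) =
      κ * ∫ x, (7 * (5 / 4 : ℝ) + 3 / 4) / 4 * fpChi (R1 ^ 2) (R2 ^ 2) x ^ 2 * (fpSq x)⁻¹ ^ 5 * fpDot x (p1Disp a h U b₀ A (y₀ + x)) ^ 2 := by
    rw [← integral_const_mul]
    exact integral_congr_ae (Eventually.of_forall fun x => by ring)
  have hIcred : (∫ x, κ * ((3 / 4 : ℝ) / 4) * fpChi (R1 ^ 2) (R2 ^ 2) x ^ 2 * (fpSq x)⁻¹ ^ 4 *
        (p1Disp a h U b₀ A (y₀ + x) 0 ^ 2 + p1Disp a h U b₀ A (y₀ + x) 1 ^ 2 + p1Disp a h U b₀ A (y₀ + x) 2 ^ 2)) =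
      κ * ∫ x, (3 / 4 : ℝ) / 4 * fpChi (R1 ^ 2) (R2 ^ 2) x ^ 2 * (fpSq x)⁻¹ ^ 4 *
        (p1Disp a h U b₀ A (y₀ + x) 0 ^ 2 + p1Disp a h U b₀ A (y₀ + x) 1 ^ 2 + p1Disp a h U b₀ A (y₀ + x) 2 ^ 2) := by
    rw [← integral_const_mul]
    exact integral_congr_ae (Eventually.of_forall fun x => by ring)
  rw [hIrad] at hle_rad
  rw [hIcred] at hle_cred
  -- (10) the readouts in H12⋆'s form
  have hread_in : (∑' e : (ℤ × ℤ × ℤ) × (ℤ × ℤ × ℤ), w e * ‖u (e.1 + e.2) - u e.1 - W (hcpSite a h (e.1 + e.2) - hcpSite a h e.1)‖ ^ 2) =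
      ∑' e : (ℤ × ℤ × ℤ) × (ℤ × ℤ × ℤ), w e * fpSq (fun k => p1DispSite a h U b₀ A (e.1 + e.2) k - p1DispSite a h U b₀ A e.1 k) :=
    tsum_congr fun e => by rw [norm_sq_coreReadout_eq_fpSq ha' hh' u W A hA b₀ e.1 e.2]
  have hread_v : (∑' q : ℤ × ℤ × ℤ, wv q * ‖u (q + sv) - u q - W (hcpSite a h (q + sv) - hcpSite a h q)‖ ^ 2) =
      ∑' q : ℤ × ℤ × ℤ, wv q * fpSq (fun k => p1DispSite a h U b₀ A (q + sv) k - p1DispSite a h U b₀ A q k) :=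
    tsum_congr fun q => by rw [norm_sq_coreReadout_eq_fpSq ha' hh' u W A hA b₀ q sv]
  rw [hread_in, hread_v]
  -- (11) combine
  have hκN : κ * (∫ x, fpChi (R1 ^ 2) (R2 ^ 2) x ^ 2 *
      fpNumI (5 / 2) (5 / 2) (5 / 4) (3 / 4) x (p1Disp a h U b₀ A (y₀ + x)) (fpGrad (fun y => p1Disp a h U b₀ A (y₀ + y)) x)) =
      κ * ((∫ x, fpChi (R1 ^ 2) (R2 ^ 2) x ^ 2 *
        ((5 / 2) * (1 / 24 * (fpSq x)⁻¹ ^ 3 * fpSymSq (fpGrad (fun y => p1Disp a h U b₀ A (y₀ + y)) x)) +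
          (5 / 2) * (1 / 24 * (fpSq x)⁻¹ ^ 3 * (fpFrob (fpGrad (fun y => p1Disp a h U b₀ A (y₀ + y)) x) -
            fpSymSq (fpGrad (fun y => p1Disp a h U b₀ A (y₀ + y)) x))))) +
      (∫ x, (7 * (5 / 4 : ℝ) + 3 / 4) / 4 * fpChi (R1 ^ 2) (R2 ^ 2) x ^ 2 * (fpSq x)⁻¹ ^ 5 * fpDot x (p1Disp a h U b₀ A (y₀ + x)) ^ 2) -
      ∫ x, (3 / 4 : ℝ) / 4 * fpChi (R1 ^ 2) (R2 ^ 2) x ^ 2 * (fpSq x)⁻¹ ^ 4 *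
        (p1Disp a h U b₀ A (y₀ + x) 0 ^ 2 + p1Disp a h U b₀ A (y₀ + x) 1 ^ 2 + p1Disp a h U b₀ A (y₀ + x) 2 ^ 2)) := by
    rw [hsplit]
  rw [hgrad] at hκN
  rw [hflux] at hfar
  nlinarith [hle_in, hle_v, hle_rad, hle_cred, hBsum, hκN, hfar, hκ]

end Summit.AtomisticToContinuum.Crystallization.Theorems.StrictSplittingRuleBirth

end
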